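import Summits.BirchSwinnertonDyer.BirchSwinnertonDyer.Theorems.ResidualThetaTransportAtTwoResidualSignedLambdaLowerCMAtTwoOrthAtTwo
import Summits.BirchSwinnertonDyer.BirchSwinnertonDyer.Theorems.ResidualThetaTransportAtTwoResidualSignedLambdaLowerCMAtTwoLocalBlockUnramified
import HarnessLib

/-!
# GLUE clause (4) AT THE PINS: `Sel₀` is killed by BOTH halves of the one-pair pairing — `c₂ t (loc₂ s) + Σ_{w,c} χ_{w,c} (locAway s w c) = 0`

Route `ResidualThetaTransportAtTwo` (RTT), crux RSL_g `ResidualSignedLambdaLowerCMAtTwo` (stmt-BirchSwinnertonDyer-22608), line «onepair» (v3d), ASSEMBLY-SPEC-g19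
§1 row C4 `SupplyOrth` — the part that does not need the supply datum's names: everything up to `supplyPair`'s unfolding. Seat
`prover-bsd-wall-tp2-p2x-w2` g20 (`--supports`, closes nothing). THEOREMS ONLY. BSD is not proved by any of this.

* §1 `OnePair.locKer_eq_resH1Hom` — the AwayTwo frame's `locKer S κ ρ w` (`kerLocOf` of `cofreeGaloisModule`) IS the subgroup-`H¹` restriction
  `resH1Hom (resGalSubgroup κ.kerSubgroup ℚ_w) (A_ρ → A_{ρ|w})` of w3's `LocalBlockUnramified` (definitional: the two cohomology dialects agree,
  `discreteTopRep_cofree_eq`).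
* §2 `OnePair.locKer_eq_zero_of_mem_unramifiedKer` (`w ∤ 2`, cyclotomic `κ`: unramified ⟹ locally trivial, w3 g16
  `LocalBlockCount.loc_eq_zero_of_mem_unramifiedKer` + `exists_not_mem_localSubgroup_of_isCyclotomic`), `OnePair.locAway_eq_zero_of_forall_conjH1_mem_unramifiedKer`,
  **`OnePairPins.locAway_eq_zero_of_mem_Sel₀`** (the `S₀`-clause of `π.hSel₀` kills every `locAway s w c`), `OnePairPins.sum_locAway_eq_zero_of_mem_Sel₀`.
* §3 **`OnePairPins.c₂_add_sum_locAway_eq_zero_of_mem_Sel₀`** — with the 2-adic half `OrthAtTwo` (`c₂_locKer_eq_zero_of_mem_Sel₀`, p702121):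
  for `s ∈ π.Sel₀`, every functional `t` and every `χ ∈ P_{S₀}`, `π₂.c₂ t (locKer … π.v s) + ∑_{w ∈ S₀} ∑ᶠ_{c} χ w c (locAway s w c) = 0` — the integrand of
  `horth` for `supplyPair (F, χ) s = c̄₂ F s + Σ…` once `F = colN t` (`colN_surjective`, LEAD's `…OnePairSupplyDefs`).

References: [GreenbergVatsal2000] §2 p. 17 («`G_η/I_η` has profinite order prime to `p`»), Prop. 2.4; [Greenberg1989] §1 p. 98 (3); [Kobayashi2003] (8.23) (p. 18);
[SerreGaloisCohomology1997] I §2.4, I §2.6 (b).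
-/

set_option autoImplicit false
-- the Theorems namespace of this sub repeats the summit name by design (D-0017 nested layout)
set_option linter.dupNamespace false

noncomputable section

open scoped Classical

namespace Summit.BirchSwinnertonDyer.BirchSwinnertonDyer.Theorems.OnePair

open CategoryTheory Field NumberField IsDedekindDomain
  Literature.NumberTheory.EllipticCurves Literature.NumberTheory.GaloisRepresentations
  Literature.NumberTheory.EllipticCurves.GreenbergSelmer Literature.NumberTheory.EllipticCurves.CyclotomicLayer
  Literature.NumberTheory.EllipticCurves.Kato2004 ZpExtension
  Summit.BirchSwinnertonDyer.BirchSwinnertonDyer.Theorems.ThetaTransport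

variable {S : Set (PadicAlgCl 2)} {κ : ZpExtension ℚ 2} {ρ : FramedGaloisRep ℚ ↥(padicCoeffIntegers S) 2}

/-! ## §1 The frame's `locKer` is the subgroup-`H¹` restriction -/

/-- **`locKer S κ ρ w = resH1Hom (resGalSubgroup κ.kerSubgroup ℚ_w) (A_ρ → A_{ρ|w})`** (the two cohomology dialects of the tree agree definitionally:
`discreteTopRep U (Cofree ρ F) = subgroupRep (cofreeGaloisModule S ρ).toTopRep U`, `kerGroup κ w = localSubgroup κ.kerSubgroup ℚ_w`,
`resGalSubgroup = resGalSubgroupOfEmb … (closureEmb ℚ_w)`). [cite: SerreGaloisCohomology1997, I §2.4] -/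
theorem locKer_eq_resH1Hom (w : HeightOneSpectrum (𝓞 ℚ)) (x : subgroupH1 κ.kerSubgroup (Cofree ρ ↥(padicCoeffField S))) :
    locKer S κ ρ w x =
      resH1Hom (resGalSubgroup κ.kerSubgroup (w.adicCompletion ℚ))
        (AddMonoidHom.mk' (fun a ↦ (a : Cofree (ρ.toLocal w) ↥(padicCoeffField S))) (fun _ _ ↦ rfl) :
          Cofree ρ ↥(padicCoeffField S) →+ Cofree (ρ.toLocal w) ↥(padicCoeffField S))
        (fun _ _ ↦ rfl) x :=
  rfl

/-! ## §2 Unramified at `w ∤ 2` ⟹ `locKer = 0`, `locAway = 0`; the `S₀`-clause of `Sel₀` -/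

/-- **Unramified at `w ∤ 2` ⟹ locally trivial at `w`** in the frame's currency: for the cyclotomic `κ` (no finite place splits completely) and `w ∤ 2`,
`s ∈ unramifiedKer Γ_∞ A_ρ w ⟹ locKer S κ ρ w s = 0` (w3 g16 `loc_eq_zero_of_mem_unramifiedKer`). [cite: GreenbergVatsal2000, §2 p. 17 and Prop. 2.4] -/
theorem locKer_eq_zero_of_mem_unramifiedKer (hκ : κ.IsCyclotomic) {w : HeightOneSpectrum (𝓞 ℚ)} (h2w : ((2 : ℕ) : 𝓞 ℚ) ∉ w.asIdeal)
    (s : subgroupH1 κ.kerSubgroup (Cofree ρ ↥(padicCoeffField S)))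
    (hs : s ∈ GreenbergVatsal2000.unramifiedKer κ.kerSubgroup (Cofree ρ ↥(padicCoeffField S)) w) : locKer S κ ρ w s = 0 := by
  rw [locKer_eq_resH1Hom]
  exact LocalBlockCount.loc_eq_zero_of_mem_unramifiedKer S ρ κ h2w (LocalBlockCount.exists_not_mem_localSubgroup_of_isCyclotomic (hκ := hκ) (v := w)) s hs

/-- **Every `locAway` component of a class unramified (with all its conjugates) at the places of `S₀ ∌ 2` vanishes.** [cite: GreenbergVatsal2000, §2 p. 17] -/
theorem locAway_eq_zero_of_forall_conjH1_mem_unramifiedKer (hκ : κ.IsCyclotomic) {S₀ : Finset (HeightOneSpectrum (𝓞 ℚ))}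
    (hS₀ : ∀ v ∈ S₀, ((2 : ℕ) : 𝓞 ℚ) ∉ v.asIdeal) (s : subgroupH1 κ.kerSubgroup (Cofree ρ ↥(padicCoeffField S)))
    (hs : ∀ w ∈ S₀, ∀ σ : absoluteGaloisGroup ℚ,
      conjH1 κ.kerSubgroup (Cofree ρ ↥(padicCoeffField S)) σ s ∈ GreenbergVatsal2000.unramifiedKer κ.kerSubgroup (Cofree ρ ↥(padicCoeffField S)) w)
    (w : ↥S₀) (c : Cosets κ (w : HeightOneSpectrum (𝓞 ℚ))) : locAway S κ ρ S₀ s w c = 0 :=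
  locKer_eq_zero_of_mem_unramifiedKer hκ (hS₀ w w.2) _ (hs w w.2 c.out)

variable {S₀ : Finset (HeightOneSpectrum (𝓞 ℚ))} {W : WeierstrassCurve ℚ} [W.IsElliptic] {γ : absoluteGaloisGroup ℚ} {n : ℕ}
  {Θ : ∀ v : HeightOneSpectrum (𝓞 ℚ), ((2 : ℕ) : 𝓞 ℚ) ∈ v.asIdeal → (Cofree ρ ↥(padicCoeffField S) ≃+ (Fin n → ↥(W.geomPrimaryTorsion 2)))}
  {hΘ : ∀ v hv (δ : absoluteGaloisGroup (v.adicCompletion ℚ)) m i,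
    Θ v hv (resGalOfEmb (closureEmb (K := ℚ) (v.adicCompletion ℚ)) δ • m) i = resGalOfEmb (closureEmb (K := ℚ) (v.adicCompletion ℚ)) δ • Θ v hv m i}
  {I : Kato2004.IwasawaH1DataCoeff (FramedGaloisRep.toGaloisRep ρ) 2 κ γ}
  {Sg : AddSubgroup (subgroupH1 κ.kerSubgroup (Cofree ρ ↥(padicCoeffField S)))} [Module ↥(padicCoeffIntegers S) ↥Sg]
  (π : OnePairPins S W κ γ S₀ n ρ Θ hΘ I Sg)

/-- **The `S₀`-clause of `π.hSel₀` kills every `locAway` component**: for `s ∈ π.Sel₀` (conjugates unramified at every `w ∈ S₀`), `locAway s w c = 0` for all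
`w ∈ S₀`, `c ∈ C_w` (`S₀ ∌ 2`, cyclotomic `κ`). [cite: GreenbergVatsal2000, §2 p. 17] [cite: Greenberg1989, §1 p. 98 (3)] -/
theorem OnePairPins.locAway_eq_zero_of_mem_Sel₀ (hκ : κ.IsCyclotomic) (hS₀ : ∀ v ∈ S₀, ((2 : ℕ) : 𝓞 ℚ) ∉ v.asIdeal) (s : ↥Sg) (hs : s ∈ π.Sel₀)
    (w : ↥S₀) (c : Cosets κ (w : HeightOneSpectrum (𝓞 ℚ))) :
    locAway S κ ρ S₀ (s : subgroupH1 κ.kerSubgroup (Cofree ρ ↥(padicCoeffField S))) w c = 0 :=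
  locAway_eq_zero_of_forall_conjH1_mem_unramifiedKer hκ hS₀ _ ((π.mem_Sel₀_iff s).mp hs).2 w c

/-- **Hence the whole `S₀`-side sum vanishes on `Sel₀`**: `∑_{w ∈ S₀} ∑ᶠ_{c} χ w c (locAway s w c) = 0` for every `χ ∈ P_{S₀}`. [cite: GreenbergVatsal2000, §2 Prop. 2.4] -/
theorem OnePairPins.sum_locAway_eq_zero_of_mem_Sel₀ (hκ : κ.IsCyclotomic) (hS₀ : ∀ v ∈ S₀, ((2 : ℕ) : 𝓞 ℚ) ∉ v.asIdeal) (s : ↥Sg) (hs : s ∈ π.Sel₀)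
    (χ : PAway S κ ρ S₀) :
    ∑ w : ↥S₀, ∑ᶠ c : Cosets κ (w : HeightOneSpectrum (𝓞 ℚ)),
      χ w c (locAway S κ ρ S₀ (s : subgroupH1 κ.kerSubgroup (Cofree ρ ↥(padicCoeffField S))) w c) = 0 := by
  refine Finset.sum_eq_zero fun w _ ↦ finsum_eq_zero_of_forall_eq_zero fun c ↦ ?_
  rw [π.locAway_eq_zero_of_mem_Sel₀ hκ hS₀ s hs w c, map_zero]

/-! ## §3 Clause (4) at the pins -/

variable [Module ℤ_[2] (Dloc S κ ρ π.v)] (π₂ : AtTwoPins S κ ρ S₀ W γ n Θ hΘ I Sg π)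

/-- **GLUE clause (4) AT THE PINS — `Sel₀` is orthogonal to everything.** For `s ∈ π.Sel₀`, every functional `t` on the tower points at `π.v` and every
`χ ∈ P_{S₀}`: `π₂.c₂ t (locKer … π.v s) + ∑_{w ∈ S₀} ∑ᶠ_{c} χ w c (locAway s w c) = 0` (2-adic half: strict Kummer datum, `OrthAtTwo`; `S₀`-half: §2).
[cite: Kobayashi2003, Thm. 6.2 and (8.23) (p. 18)] [cite: GreenbergVatsal2000, §2 p. 17, Prop. 2.4] -/
theorem OnePairPins.c₂_add_sum_locAway_eq_zero_of_mem_Sel₀ (hκ : κ.IsCyclotomic) (hS₀ : ∀ v ∈ S₀, ((2 : ℕ) : 𝓞 ℚ) ∉ v.asIdeal)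
    (s : ↥Sg) (hs : s ∈ π.Sel₀)
    (t : (Fin n → ↥(Sprung2012.localTowerPointsOfEmb κ (closureEmb (K := ℚ) (π.v.adicCompletion ℚ)) W)) →+ ℤ_[2]) (χ : PAway S κ ρ S₀) :
    π₂.c₂ t (locKer S κ ρ π.v (s : subgroupH1 κ.kerSubgroup (Cofree ρ ↥(padicCoeffField S)))) +
      ∑ w : ↥S₀, ∑ᶠ c : Cosets κ (w : HeightOneSpectrum (𝓞 ℚ)),
        χ w c (locAway S κ ρ S₀ (s : subgroupH1 κ.kerSubgroup (Cofree ρ ↥(padicCoeffField S))) w c) = 0 := by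
  rw [c₂_locKer_eq_zero_of_mem_Sel₀ π π₂ s hs t, π.sum_locAway_eq_zero_of_mem_Sel₀ hκ hS₀ s hs χ, add_zero]

end Summit.BirchSwinnertonDyer.BirchSwinnertonDyer.Theorems.OnePair

end
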